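import Summits.QuantumFields.GaugeBoot.Rows.KZL2HD3HTab
import HarnessLib

/-!
# Gauge-boot: kernel check of the raw `H` class table of the kz-L2-H-3D problems, rows 210–285 (part 5/7)

Cell `pub-gaugeboot` (HOME `run/shared/lean/pub/pub-gaugeboot/`), seat lean1 (torus layer for rows C1–C2 (and C41–C50) = the certified
kz-L2-H-3D windows: label set, raw blocks, class/witness tables, the reduction identity, per-β bindings).

HONEST FRAMING (page 1 of every file of this cell): certified bounds on lattice expectations at STATED coupling,
gauge group, dimension and torus size; NOT a mass gap, NOT a continuum limit, NOT a string tension, NOT large `N`.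
The venture is explicitly NOT Yang–Mills-summit-bearing (barriers `FixedCouplingUltralocality`,
`PerturbativeInvisibility`).

`hcanon_rows_<lo>_<hi> : ∀ i, lo ≤ i < hi → ∀ j ≥ i, KZL2HD3.HCanonOK i j`, each range one closed computation (`decide +kernel`);
assembled in `KZL2HD3Canon`.
-/

noncomputable section

open Literature.MathematicalPhysics.QuantumFieldTheory

namespace Summit.QuantumFields.GaugeBoot

namespace KZL2HD3

set_option maxHeartbeats 0 in
/-- Rows `210 ≤ i < 224` of the `H` class table of the kz-L2-H-3D problems canonicalise (4711 entries; kernel). -/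
theorem hcanon_rows_210_224 : ∀ i : Fin 553, 210 ≤ i.val → i.val < 224 → ∀ j : Fin 553, i.val ≤ j.val → KZL2HD3.HCanonOK i j := by
  decide +kernel

set_option maxHeartbeats 0 in
/-- Rows `224 ≤ i < 238` of the `H` class table of the kz-L2-H-3D problems canonicalise (4515 entries; kernel). -/
theorem hcanon_rows_224_238 : ∀ i : Fin 553, 224 ≤ i.val → i.val < 238 → ∀ j : Fin 553, i.val ≤ j.val → KZL2HD3.HCanonOK i j := by
  decide +kernel

set_option maxHeartbeats 0 in
/-- Rows `238 ≤ i < 253` of the `H` class table of the kz-L2-H-3D problems canonicalise (4620 entries; kernel). -/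
theorem hcanon_rows_238_253 : ∀ i : Fin 553, 238 ≤ i.val → i.val < 253 → ∀ j : Fin 553, i.val ≤ j.val → KZL2HD3.HCanonOK i j := by
  decide +kernel

set_option maxHeartbeats 0 in
/-- Rows `253 ≤ i < 269` of the `H` class table of the kz-L2-H-3D problems canonicalise (4680 entries; kernel). -/
theorem hcanon_rows_253_269 : ∀ i : Fin 553, 253 ≤ i.val → i.val < 269 → ∀ j : Fin 553, i.val ≤ j.val → KZL2HD3.HCanonOK i j := by
  decide +kernel

set_option maxHeartbeats 0 in
/-- Rows `269 ≤ i < 286` of the `H` class table of the kz-L2-H-3D problems canonicalise (4692 entries; kernel). -/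
theorem hcanon_rows_269_286 : ∀ i : Fin 553, 269 ≤ i.val → i.val < 286 → ∀ j : Fin 553, i.val ≤ j.val → KZL2HD3.HCanonOK i j := by
  decide +kernel

end KZL2HD3

end Summit.QuantumFields.GaugeBoot

end
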